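import Literature.NumberTheory.Rogawski1990.EndoscopicStableOrbitalSum
import Mathlib.Analysis.Fourier.FiniteAbelian.PontryaginDuality
import HarnessLib

/-!
# `κ`-regrouping: Fourier inversion on the finite abelian invariant group `𝔇` behind the (pre-)stabilisation
# `Σ_κ Φ^κ(γ, ·) = |𝔇| · (sum over the classes with trivial invariant)` (Rogawski 1990, (4.1.1) p. 39–40, (5.4.3) p. 72, §14.5 pp. 237–238)

Topic `NumberTheory/Rogawski1990`; namespace `Literature.NumberTheory.Rogawski1990`; THEOREMS ONLY (no def, no named fact, no instance, no
notation), on top of ★ `StableConjugacyU3` (p08: the letters `kappaOrbitalSum σ H Φ w γ = Σᶠ_{[γ′] ⊂ 𝒪_st(γ)} w[γ′] Φ[γ′]`, `stableOrbitalSum`,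
`conjClassesIn`), ★ `EndoscopicStableOrbitalSum` (`StableClassH.orbitalSum`, the `H`-side classes) and Mathlib's characters of finite abelian groups
(`AddChar A ℂ`, orthogonality `AddChar.sum_apply_eq_ite`).

[Rogawski1990, §4.1 (4.1.1) p. 39–40]: «`Φ^κ(γ, f) = Σ_{γ′} κ(inv(γ, γ′)) Φ(γ′, f)` … where `{γ′}` is a set of representatives for the conjugacy classes
within `𝒪_st(γ)` … If `κ` is trivial, `Φ^κ(γ, f)` is called a stable orbital integral»; [§5.4 pp. 71–72, (5.4.1)–(5.4.3)]: `J_G(𝒪_st, f) = … Σ_{γ ∈ 𝒞_𝔸}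
Σ_{κ ∈ ℛ(G_{γ₀}/F)} κ(obs(γ)) Φ(γ, f) = ε_st(γ₀)⁻¹ z_G(γ₀) τ(G) Σ_κ Φ^κ(γ₀, f)` — summing `κ(obs γ)` over the characters `κ` of the finite abelian group
picks out (`|ℛ|` times) the classes with TRIVIAL obstruction; [§14.5 pp. 237–238, Lemma 14.5.2]: the same Fourier inversion on `𝔇` with `|𝔇| = 2`,
`Φ(γ′, f′) = ½ (Φ^st + Φ^κ)`.

The invariant map `inv : (classes) → A` is an INPUT here (Rogawski's `inv(γ, ·)` with values in `𝔇(T/F) = ker(H¹(F, T) → H¹(F, G))`, ★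
`NonAbelianH1StableClasses`, resp. `obs` globally; its construction on `unitaryGroup` classes is the T1-orb dictionary, not this file):
* §1 ABSTRACT, any index type `I`, `inv : I → A`, `A` a finite additive commutative group: `sum_addChar_sum_mul_eq` (`Σ_κ Σ_{i ∈ s} κ(inv i) Φ i
  = |A| Σ_{i ∈ s, inv i = 0} Φ i`), the fibre-by-fibre Fourier inversion `sum_addChar_apply_neg_mul_sum_eq` (`Σ_κ κ(−a) Σ_i κ(inv i) Φ i =
  |A| Σ_{inv i = a} Φ i`) and its solved forms;
* §2 DRESS in the letters of ★ `StableConjugacyU3`: with `J^κ(𝒪_st(γ), Φ) = kappaOrbitalSum σ H Φ (κ ∘ inv) γ`,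
  **`finsum_mem_inter_fibre_eq_inv_card_mul_sum_kappaOrbitalSum`**: `Σᶠ_{[γ′] ⊂ 𝒪_st(γ), inv[γ′] = a} Φ[γ′] = |A|⁻¹ Σ_κ κ(−a) J^κ`; `a = 0`: the
  sub-sum over the classes with trivial invariant is `|A|⁻¹ Σ_κ J^κ` (the honest form of «Σ_{[γ′] ⊂ 𝒪_st} Φ[γ′] = |A|⁻¹ Σ_κ J^κ»: equality with the
  FULL stable sum `stableOrbitalSum` iff `inv` vanishes on the support, `stableOrbitalSum_eq_inv_card_mul_sum_kappaOrbitalSum_of_forall_eq_zero`);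
  with `inv` INJECTIVE on `𝒪_st(γ)` (the local picture, ★ R4): EACH `Φ[γ′] = |A|⁻¹ Σ_κ κ(−inv[γ′]) J^κ` (`eq_inv_card_mul_sum_kappaOrbitalSum_of_injOn`);
* §3 the same on the endoscopic side `H = U(J₂) × U(J₁)` for the fibres of ★ `StableClassH.ofConjClass`.
-/

noncomputable section

open scoped BigOperators

namespace Literature.NumberTheory.Rogawski1990

open scoped MatrixGroups
open Literature.AlgebraicGeometry.ShimuraVarieties (unitaryGroup)

/-! ## §1 Abstract: character sums over a finite abelian group against an invariant map -/

section Abstract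

variable {I : Type*} {A : Type*} [AddCommGroup A] [Fintype A] [DecidableEq A] (inv : I → A) (Φ : I → ℂ)

omit [Fintype A] [DecidableEq A] in
/-- A character of a finite abelian group does not vanish (`κ(a) κ(−a) = κ(0) = 1`). [cite: Rogawski1990, §4.1 (4.1.1) p. 39] -/
theorem addChar_apply_ne_zero (κ : AddChar A ℂ) (a : A) : κ a ≠ 0 := by
  have h : κ a * κ (-a) = 1 := by rw [← AddChar.map_add_eq_mul, add_neg_cancel, AddChar.map_zero_eq_one]
  exact left_ne_zero_of_mul_eq_one h

/-- `Σ_κ κ(inv i − a) = |A| · [inv i = a]` (character orthogonality ★ `AddChar.sum_apply_eq_ite`). [cite: Rogawski1990, §5.4 (5.4.3) p. 72] -/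
theorem sum_addChar_apply_sub_eq_ite (i : I) (a : A) :
    ∑ κ : AddChar A ℂ, κ (inv i - a) = if inv i = a then (Fintype.card A : ℂ) else 0 := by
  rw [AddChar.sum_apply_eq_ite]
  simp only [sub_eq_zero]

/-- **`Σ_κ Σ_{i ∈ s} κ(inv i) Φ i = |A| · Σ_{i ∈ s, inv i = 0} Φ i`**: summing the `κ`-twisted sums over all characters `κ` of the finite abelian group
`A` picks out the indices with TRIVIAL invariant. [cite: Rogawski1990, §5.4 (5.4.3) p. 72] -/
theorem sum_addChar_sum_mul_eq (s : Finset I) :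
    ∑ κ : AddChar A ℂ, ∑ i ∈ s, κ (inv i) * Φ i = (Fintype.card A : ℂ) * ∑ i ∈ s with inv i = 0, Φ i := by
  rw [Finset.sum_comm, Finset.sum_filter, Finset.mul_sum]
  refine Finset.sum_congr rfl fun i _ => ?_
  rw [← Finset.sum_mul, AddChar.sum_apply_eq_ite]
  split_ifs <;> simp

/-- **Fourier inversion, fibre by fibre: `Σ_κ κ(−a) · Σ_{i ∈ s} κ(inv i) Φ i = |A| · Σ_{i ∈ s, inv i = a} Φ i`.** [cite: Rogawski1990, §14.5 Lemma 14.5.2 pp. 237–238] -/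
theorem sum_addChar_apply_neg_mul_sum_eq (s : Finset I) (a : A) :
    ∑ κ : AddChar A ℂ, κ (-a) * ∑ i ∈ s, κ (inv i) * Φ i = (Fintype.card A : ℂ) * ∑ i ∈ s with inv i = a, Φ i := by
  have h : ∀ κ : AddChar A ℂ, κ (-a) * ∑ i ∈ s, κ (inv i) * Φ i = ∑ i ∈ s, κ (inv i - a) * Φ i := fun κ => by
    rw [Finset.mul_sum]
    refine Finset.sum_congr rfl fun i _ => ?_
    rw [← mul_assoc, ← AddChar.map_add_eq_mul, neg_add_eq_sub]
  simp_rw [h]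
  rw [Finset.sum_comm, Finset.sum_filter, Finset.mul_sum]
  refine Finset.sum_congr rfl fun i _ => ?_
  rw [← Finset.sum_mul, sum_addChar_apply_sub_eq_ite]
  split_ifs <;> simp

/-- Solved form: `Σ_{i ∈ s, inv i = a} Φ i = |A|⁻¹ · Σ_κ κ(−a) · Σ_{i ∈ s} κ(inv i) Φ i`. [cite: Rogawski1990, §14.5 Lemma 14.5.2 pp. 237–238] -/
theorem sum_filter_eq_inv_card_mul_sum_addChar (s : Finset I) (a : A) :
    ∑ i ∈ s with inv i = a, Φ i = (Fintype.card A : ℂ)⁻¹ * ∑ κ : AddChar A ℂ, κ (-a) * ∑ i ∈ s, κ (inv i) * Φ i := by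
  have hA : (Fintype.card A : ℂ) ≠ 0 := Nat.cast_ne_zero.mpr Fintype.card_ne_zero
  rw [sum_addChar_apply_neg_mul_sum_eq, ← mul_assoc, inv_mul_cancel₀ hA, one_mul]

omit [Fintype A] [DecidableEq A] in
/-- The `κ`-twisted `finsum` over a set `S` meeting the support of `Φ` finitely is the `Finset` sum over `S ∩ supp Φ`.
[cite: Rogawski1990, §4.1 (4.1.1) p. 39] -/
theorem finsum_mem_addChar_mul_eq_sum (κ : AddChar A ℂ) (S : Set I) (hS : (S ∩ Function.support Φ).Finite) :
    ∑ᶠ i ∈ S, κ (inv i) * Φ i = ∑ i ∈ hS.toFinset, κ (inv i) * Φ i := by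
  refine finsum_mem_eq_sum_of_inter_support_eq (fun i => κ (inv i) * Φ i) ?_
  have hsupp : Function.support (fun i => κ (inv i) * Φ i) = Function.support Φ := by
    ext i
    simp only [Function.mem_support, ne_eq, mul_eq_zero, addChar_apply_ne_zero, false_or]
  rw [hsupp, Set.Finite.coe_toFinset, Set.inter_assoc, Set.inter_self]

omit [AddCommGroup A] [Fintype A] in
/-- The fibre `finsum` is the filtered `Finset` sum. [cite: Rogawski1990, §4.1 (4.1.1) p. 39] -/
theorem finsum_mem_inter_fibre_eq_sum_filter (S : Set I) (hS : (S ∩ Function.support Φ).Finite) (a : A) :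
    ∑ᶠ i ∈ S ∩ inv ⁻¹' {a}, Φ i = ∑ i ∈ hS.toFinset with inv i = a, Φ i := by
  refine finsum_mem_eq_sum_of_inter_support_eq Φ ?_
  ext i
  simp only [Set.mem_inter_iff, Set.mem_preimage, Set.mem_singleton_iff, Function.mem_support, ne_eq, Finset.coe_filter,
    Set.Finite.mem_toFinset, Set.mem_setOf_eq]
  tauto

/-- **`finsum` form: `Σ_κ Σᶠ_{i ∈ S} κ(inv i) Φ i = |A| · Σᶠ_{i ∈ S, inv i = 0} Φ i`** for `S` meeting the support of `Φ` finitely.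
[cite: Rogawski1990, §5.4 (5.4.3) p. 72] -/
theorem sum_addChar_finsum_mem_mul_eq (S : Set I) (hS : (S ∩ Function.support Φ).Finite) :
    ∑ κ : AddChar A ℂ, ∑ᶠ i ∈ S, κ (inv i) * Φ i = (Fintype.card A : ℂ) * ∑ᶠ i ∈ S ∩ inv ⁻¹' {0}, Φ i := by
  simp_rw [finsum_mem_addChar_mul_eq_sum inv Φ _ S hS]
  rw [finsum_mem_inter_fibre_eq_sum_filter inv Φ S hS, sum_addChar_sum_mul_eq]

/-- **`finsum` Fourier inversion: `Σᶠ_{i ∈ S, inv i = a} Φ i = |A|⁻¹ Σ_κ κ(−a) Σᶠ_{i ∈ S} κ(inv i) Φ i`.** [cite: Rogawski1990, §14.5 Lemma 14.5.2 pp. 237–238] -/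
theorem finsum_mem_inter_fibre_eq_inv_card_mul_sum_addChar (S : Set I) (hS : (S ∩ Function.support Φ).Finite) (a : A) :
    ∑ᶠ i ∈ S ∩ inv ⁻¹' {a}, Φ i = (Fintype.card A : ℂ)⁻¹ * ∑ κ : AddChar A ℂ, κ (-a) * ∑ᶠ i ∈ S, κ (inv i) * Φ i := by
  simp_rw [finsum_mem_addChar_mul_eq_sum inv Φ _ S hS]
  rw [finsum_mem_inter_fibre_eq_sum_filter inv Φ S hS, sum_filter_eq_inv_card_mul_sum_addChar]

/-- With `inv` INJECTIVE on `S` (the local picture: `inv(γ, ·)` is a bijection onto `𝔇`), each single value is recovered: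
`Φ i = |A|⁻¹ Σ_κ κ(−inv i) Σᶠ_{j ∈ S} κ(inv j) Φ j` for `i ∈ S`. [cite: Rogawski1990, §14.5 Lemma 14.5.2 pp. 237–238] -/
theorem eq_inv_card_mul_sum_addChar_of_injOn (S : Set I) (hS : (S ∩ Function.support Φ).Finite) (hinj : Set.InjOn inv S) {i : I}
    (hi : i ∈ S) : Φ i = (Fintype.card A : ℂ)⁻¹ * ∑ κ : AddChar A ℂ, κ (-inv i) * ∑ᶠ j ∈ S, κ (inv j) * Φ j := by
  rw [← finsum_mem_inter_fibre_eq_inv_card_mul_sum_addChar inv Φ S hS (inv i)]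
  have hfib : S ∩ inv ⁻¹' {inv i} = {i} := by
    ext j
    simp only [Set.mem_inter_iff, Set.mem_preimage, Set.mem_singleton_iff]
    refine ⟨fun h => hinj h.1 hi h.2, ?_⟩
    rintro rfl
    exact ⟨hi, rfl⟩
  rw [hfib, finsum_mem_singleton]

end Abstract

/-! ## §2 Dress: `κ`-orbital sums `J^κ(𝒪_st(γ), Φ) = Σᶠ_{[γ′] ⊂ 𝒪_st(γ)} κ(inv[γ′]) Φ[γ′]` of ★ `StableConjugacyU3` -/

section Unitary

variable {R : Type*} [CommRing R] {n : Type*} [Fintype n] [DecidableEq n] {σ : R →+* R} {H : Matrix n n R}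
  {A : Type*} [AddCommGroup A] [Fintype A] [DecidableEq A]
  (inv : ConjClasses (unitaryGroup σ H) → A) (Φ : ConjClasses (unitaryGroup σ H) → ℂ) (γ : unitaryGroup σ H)

/-- **`Σ_κ J^κ(𝒪_st(γ), Φ) = |A| · Σᶠ_{[γ′] ⊂ 𝒪_st(γ), inv[γ′] = 0} Φ[γ′]`** for the `κ`-orbital sums `J^κ = kappaOrbitalSum σ H Φ (κ ∘ inv) γ` of
★ `StableConjugacyU3` (finitely many classes of `𝒪_st(γ)` meeting the support of `Φ`): the pre-stabilisation identity (5.4.3) in the abstract.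
[cite: Rogawski1990, §5.4 (5.4.3) p. 72] -/
theorem sum_addChar_kappaOrbitalSum_eq (hfin : (conjClassesIn σ H γ ∩ Function.support Φ).Finite) :
    ∑ κ : AddChar A ℂ, kappaOrbitalSum σ H Φ (fun c => κ (inv c)) γ =
      (Fintype.card A : ℂ) * ∑ᶠ c ∈ conjClassesIn σ H γ ∩ inv ⁻¹' {0}, Φ c :=
  sum_addChar_finsum_mem_mul_eq inv Φ (conjClassesIn σ H γ) hfin

/-- **Fourier inversion on `𝒪_st(γ)`: `Σᶠ_{[γ′] ⊂ 𝒪_st(γ), inv[γ′] = a} Φ[γ′] = |A|⁻¹ Σ_κ κ(−a) J^κ(𝒪_st(γ), Φ)`.**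
[cite: Rogawski1990, §14.5 Lemma 14.5.2 pp. 237–238] -/
theorem finsum_mem_conjClassesIn_fibre_eq (hfin : (conjClassesIn σ H γ ∩ Function.support Φ).Finite) (a : A) :
    ∑ᶠ c ∈ conjClassesIn σ H γ ∩ inv ⁻¹' {a}, Φ c =
      (Fintype.card A : ℂ)⁻¹ * ∑ κ : AddChar A ℂ, κ (-a) * kappaOrbitalSum σ H Φ (fun c => κ (inv c)) γ :=
  finsum_mem_inter_fibre_eq_inv_card_mul_sum_addChar inv Φ (conjClassesIn σ H γ) hfin a

/-- The classes of `𝒪_st(γ)` with TRIVIAL invariant: `Σᶠ_{[γ′] ⊂ 𝒪_st(γ), inv[γ′] = 0} Φ[γ′] = |A|⁻¹ Σ_κ J^κ(𝒪_st(γ), Φ)` — the honest form of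
«`Σ_{[γ′] ⊂ 𝒪_st} Φ[γ′] = |A|⁻¹ Σ_κ J^κ`». [cite: Rogawski1990, §5.4 (5.4.3) p. 72] -/
theorem finsum_mem_conjClassesIn_inv_eq_zero_eq (hfin : (conjClassesIn σ H γ ∩ Function.support Φ).Finite) :
    ∑ᶠ c ∈ conjClassesIn σ H γ ∩ inv ⁻¹' {0}, Φ c =
      (Fintype.card A : ℂ)⁻¹ * ∑ κ : AddChar A ℂ, kappaOrbitalSum σ H Φ (fun c => κ (inv c)) γ := by
  rw [finsum_mem_conjClassesIn_fibre_eq inv Φ γ hfin 0]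
  simp only [neg_zero, AddChar.map_zero_eq_one, one_mul]

/-- If `inv` vanishes on the classes of `𝒪_st(γ)` carrying `Φ`, the FULL stable orbital sum is `|A|⁻¹ Σ_κ J^κ` (★ `stableOrbitalSum`).
[cite: Rogawski1990, §5.4 (5.4.3) p. 72] -/
theorem stableOrbitalSum_eq_inv_card_mul_sum_kappaOrbitalSum_of_forall_eq_zero (hfin : (conjClassesIn σ H γ ∩ Function.support Φ).Finite)
    (h0 : ∀ c ∈ conjClassesIn σ H γ, Φ c ≠ 0 → inv c = 0) :
    stableOrbitalSum σ H Φ γ = (Fintype.card A : ℂ)⁻¹ * ∑ κ : AddChar A ℂ, kappaOrbitalSum σ H Φ (fun c => κ (inv c)) γ := by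
  rw [← finsum_mem_conjClassesIn_inv_eq_zero_eq inv Φ γ hfin, stableOrbitalSum]
  refine finsum_mem_inter_support_eq Φ _ _ ?_
  ext c
  simp only [Set.mem_inter_iff, Set.mem_preimage, Set.mem_singleton_iff, Function.mem_support, ne_eq]
  exact ⟨fun h => ⟨⟨h.1, h0 c h.1 h.2⟩, h.2⟩, fun h => ⟨h.1.1, h.2⟩⟩

/-- **Local picture (`inv` injective on `𝒪_st(γ)`, ★ R4 `exists_fixed_conj_of_invClass_eq`): EVERY ordinary term from the `κ`-orbital sums**,
`Φ[γ′] = |A|⁻¹ Σ_κ κ(−inv[γ′]) J^κ(𝒪_st(γ), Φ)` for `[γ′] ⊂ 𝒪_st(γ)` (with `|𝔇| = 2`: `Φ(γ′) = ½ (Φ^st ± Φ^κ)`).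
[cite: Rogawski1990, §14.5 Lemma 14.5.2 pp. 237–238] -/
theorem eq_inv_card_mul_sum_kappaOrbitalSum_of_injOn (hfin : (conjClassesIn σ H γ ∩ Function.support Φ).Finite)
    (hinj : Set.InjOn inv (conjClassesIn σ H γ)) {c : ConjClasses (unitaryGroup σ H)} (hc : c ∈ conjClassesIn σ H γ) :
    Φ c = (Fintype.card A : ℂ)⁻¹ * ∑ κ : AddChar A ℂ, κ (-inv c) * kappaOrbitalSum σ H Φ (fun c => κ (inv c)) γ :=
  eq_inv_card_mul_sum_addChar_of_injOn inv Φ (conjClassesIn σ H γ) hfin hinj hc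

omit [Fintype A] [DecidableEq A] in
/-- The trivial character gives back the stable orbital sum: `J^{κ = 1} = Φ^st` (★ `stableOrbitalSum_eq_kappaOrbitalSum_one`).
[cite: Rogawski1990, §4.1 (4.1.1) p. 40] -/
theorem kappaOrbitalSum_addChar_one (inv : ConjClasses (unitaryGroup σ H) → A) (Φ : ConjClasses (unitaryGroup σ H) → ℂ) (γ : unitaryGroup σ H) :
    kappaOrbitalSum σ H Φ (fun c => (1 : AddChar A ℂ) (inv c)) γ = stableOrbitalSum σ H Φ γ := by
  simp only [AddChar.one_apply]
  exact (stableOrbitalSum_eq_kappaOrbitalSum_one Φ γ).symm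

end Unitary

/-! ## §3 The endoscopic side `H = U(J₂) × U(J₁)`: the same over the fibres of ★ `StableClassH.ofConjClass` -/

section Endoscopic

variable {R : Type*} [CommRing R] {σ : R →+* R} {J₂ : Matrix (Fin 2) (Fin 2) R} {J₁ : Matrix (Fin 1) (Fin 1) R}
  {A : Type*} [AddCommGroup A] [Fintype A] [DecidableEq A]
  (inv : ConjClasses (unitaryGroup σ J₂ × unitaryGroup σ J₁) → A) (Φ : ConjClasses (unitaryGroup σ J₂ × unitaryGroup σ J₁) → ℂ)
  (s : StableClassH σ J₂ J₁)

/-- `Σ_κ Σᶠ_{[γ_H] ⊂ 𝒪′_st} κ(inv[γ_H]) Φ[γ_H] = |A| · Σᶠ_{[γ_H] ⊂ 𝒪′_st, inv = 0} Φ[γ_H]` on a stable class of `H(F)`.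
[cite: Rogawski1990, §5.4 (5.4.3) p. 72] -/
theorem StableClassH.sum_addChar_orbitalSum_eq (hfin : (StableClassH.ofConjClass ⁻¹' {s} ∩ Function.support Φ).Finite) :
    ∑ κ : AddChar A ℂ, s.orbitalSum (fun c => κ (inv c) * Φ c) =
      (Fintype.card A : ℂ) * ∑ᶠ c ∈ StableClassH.ofConjClass ⁻¹' {s} ∩ inv ⁻¹' {0}, Φ c :=
  sum_addChar_finsum_mem_mul_eq inv Φ _ hfin

/-- Fourier inversion on a stable class of `H(F)`: `Σᶠ_{[γ_H] ⊂ 𝒪′_st, inv = a} Φ[γ_H] = |A|⁻¹ Σ_κ κ(−a) Σᶠ_{[γ_H] ⊂ 𝒪′_st} κ(inv) Φ`.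
[cite: Rogawski1990, §14.5 Lemma 14.5.2 pp. 237–238] -/
theorem StableClassH.finsum_mem_fibre_eq (hfin : (StableClassH.ofConjClass ⁻¹' {s} ∩ Function.support Φ).Finite) (a : A) :
    ∑ᶠ c ∈ StableClassH.ofConjClass ⁻¹' {s} ∩ inv ⁻¹' {a}, Φ c =
      (Fintype.card A : ℂ)⁻¹ * ∑ κ : AddChar A ℂ, κ (-a) * s.orbitalSum (fun c => κ (inv c) * Φ c) :=
  finsum_mem_inter_fibre_eq_inv_card_mul_sum_addChar inv Φ _ hfin a

end Endoscopic

end Literature.NumberTheory.Rogawski1990
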